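import Summits.QuantumFields.YangMills.Theorems.LuscherReductionTwistedTraceScalingInnerBOPackage
import Summits.QuantumFields.YangMills.Theorems.LuscherReductionTwistedTraceScalingOnionRefinedScales
import Summits.QuantumFields.YangMills.Theorems.FemtoCutoffLadderFixedLatticeLawValleyOfFloor
import HarnessLib

/-!
# C4 INNER in TWO ZONES: COARSE-UPPER(L) ⇐ INNER ONE-ORBIT at the CORE radius `β^{−s}` (any `0 < s < 1/3`) + a SHELL GAIN on `β^{−s}/2 < orbitDist < β^{−p}`
# (lane A of S-BASE, crux `TwistedTraceScaling` stmt-QuantumFields-20203, sub-target C4; design note `pub/ym-fleet/ym-luscher-20007-p1/COARSE-DESIGN.md` §22)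

DESIGN CORRECTION (§22 of the design note).  The Born–Oppenheimer comparison of the lattice kernel with `(one-site kernel at L³β) ⊗ (stiff Gaussian)` is
accurate to relative precision `O(L³|c|²)` in the slow datum `c` (second order by the symmetry lemma of `…InnerSymmetry`), and this is `o(λ_b) = o(β^{−1/3})`
only for `|c| ≪ β^{−1/6}`.  The inner ball handed to C4 by the floor normalisation has radius `β^{−p}` with `p < 1/10` (exponents of record `p = 1/40`),
and along the ABELIAN (toron) valley the Wilson weight does not confine `c` below that radius.  So the Feshbach package `InnerBOPackageAt` can only be
discharged on a CORE `{orbitDist < β^{−s}}` with `s > 1/6`; the annulus `β^{−s}/2 < orbitDist(τ_z U)`, `orbitDist(τ_z U) < β^{−p}` (the SHELL) needs a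
separate, cruder statement — a pure GAIN (sup of the Rayleigh quotient `≤ e^{−Aλ_b}λ₀` for every `A`), which holds with a margin `≍ β^{−s} ≫ λ_b` coming from the
one-site transverse confinement (linear in the valley radius, β-independent coefficient) against the `O(|c|²)` stiff correction.
THIS FILE is the kernel-checked GLUE of the two zones, entirely inside the existing onion:
* `InnerShellGainAt L δc δ` — the SHELL GAIN target text (same shape as RED's `ValleyGainAt`, support `{∃ z, orbitDist(τ_z U) < δ} ∩ {∀ z, δc/2 < orbitDist(τ_z U)}`);
* ★★ `valleyGainAt_of_shell`: `ScalesAdmissible L δ δ → InnerShellGainAt L δc δ → ValleyGainAt L δ η → ValleyGainAt L δc η` — a sup bound glues through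
  the IMS split `qform_le_inner_outer_lat` at the intermediate radius `δ` with no min–max bookkeeping (floor `levelValue_zero_ge_uniform` pays the cut);
* ★★★ `coarseNoIntruderAt_of_core_shell_pow`: for RED's exponent window `(p, q, r, m)` of `coarseNoIntruderAt_of_inner_pow` and ANY core exponent
  `0 < s < 1/3`: `InnerNoIntruderOneOrbitAt L (powScale s) → InnerShellGainAt L (powScale s) (powScale p) →` COARSE-UPPER(L) verbatim (RED's valley gain
  `valleyGainAt_of_floor_pow` + `valleyFloorAt_of_idealCmp_pow` + `riccatiN_idealCmp_pow` at radius `β^{−p}`, the shell glue above, and the onion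
  `coarseNoIntruderAt_of_valley_oneOrbit_pow₉` at the CORE radius `β^{−s}`); `…_fortieth` is the instance `(p,q,r,m) = (1/40, 17/20, 41/100, 11/200)`;
  `coarseNoIntruderAt_of_package_shell_pow` is the same with the core supplied by the Feshbach package (`innerNoIntruderOneOrbitAt_of_package`).
* `innerShellGainAt_of_valleyGainAt`: conversely a valley gain at the core radius with action threshold `η > 4|P|δ²` already contains the shell gain —
  the SHELL is «VALLEY GAIN NEAR THE VACUUM», outside the reach of lane B's exponent window but inside the near-vacuum chart of lane A.
So C4 = C4-CORE `InnerNoIntruderOneOrbitAt L (powScale s)`, `s ∈ (1/6, 1/3)` (Feshbach BO at precision `β^{−2s} = o(λ_b)`) + C4-SHELL `InnerShellGainAt L (powScale s) (powScale (1/40))`.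
HONEST FRAMING: a reduction inside the CONDITIONAL fixed-lattice programme (route R2b1); both zone statements OPEN; not infinite volume, not a gap, not Clay.
-/

set_option autoImplicit false

noncomputable section

open MeasureTheory Filter Topology Real
open scoped BigOperators
open Literature.MathematicalPhysics.QuantumFieldTheory
open Literature.MathematicalPhysics.QuantumLattice

namespace Summit.QuantumFields.YangMills.Theorems.FemtoTransferGap

variable (L : ℕ) [NeZero L]

/-- **C4-SHELL — INNER SHELL GAIN at radii `(δc, δ)`** (target text of this programme; OPEN).  For every `A`, eventually in `β`: every physical zero-flux `φ`
supported in the shell `{∃ z, orbitDist(τ_z U) < δ(β)} ∩ {∀ z, δc(β)/2 < orbitDist(τ_z U)}` has `⟨φ, K_β φ⟩ ≤ e^{−A·λ_b(L³β)} · λ₀(β, L) · ‖φ‖²`.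
Why it should hold at `(δc, δ) = (β^{−s}, β^{−p})`, `s < 1/3`: at orbit distance `t ∈ (β^{−s}/2, β^{−p})` from a twisted vacuum either the stiff (non-constant)
part carries `βS ≳ β^{1−2s} → ∞`, or the configuration is a near-abelian constant mode of size `≍ t`, where the one-site transverse zero-point energy exceeds the
vacuum value by `≍ t ≫ λ_b` (β-independent slope) while the stiff Gaussian correction is only `O(t²)`. [cite: Luscher1983, §3] -/
def InnerShellGainAt (δc δ : ℝ → ℝ) : Prop :=
  ∀ A : ℝ, ∃ β0 : ℝ, ∀ β : ℝ, β0 ≤ β → ∀ φ : GaugeConfig 3 L SU2 → ℝ, IsPhys φ →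
    (∀ U, φ U ≠ 0 → (∃ z : Fin 3 → Bool, orbitDist (TT.twist3 z U) < δ β) ∧ ∀ z : Fin 3 → Bool, δc β / 2 < orbitDist (TT.twist3 z U)) →
      qform su2Rep β φ φ ≤ Real.exp (-(A * bareLambda ((L : ℝ) ^ 3 * β))) * levelValue su2Rep L β 0 * l2 φ φ

variable {L}

/-! ## §2 The SHELL glues onto the VALLEY: a sup bound passes through the IMS cut for free -/

/-- ★★ **VALLEY GAIN down to the core radius from SHELL GAIN + VALLEY GAIN at the intermediate radius.**  If the intermediate radius `δ` is an admissible
IMS scale (`ScalesAdmissible L δ δ`), then `InnerShellGainAt L δc δ` and `ValleyGainAt L δ η` give `ValleyGainAt L δc η`: cut a valley function `φ` at radius `δ`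
(`qform_le_inner_outer_lat`); the `cos`-piece lives in the shell, the `sin`-piece in the old valley, the cut costs `o(λ_b)·λ₀‖φ‖²` through the β-uniform floor.
[cite: Luscher1983, §3] [cite: SimonB1983DiscreteSpectrum, §3] -/
theorem valleyGainAt_of_shell {δc δ η : ℝ → ℝ} (hS : ScalesAdmissible L δ δ) (hSh : InnerShellGainAt L δc δ) (hV : ValleyGainAt L δ η) :
    ValleyGainAt L δc η := by
  intro A
  obtain ⟨hδ, -, hErr⟩ := hS
  obtain ⟨βSh, hSh'⟩ := hSh (A + 1)
  obtain ⟨βV, hV'⟩ := hV (A + 1)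
  obtain ⟨βE, hE⟩ := hErr (1 / 4) (by norm_num)
  have hτ0 : (0 : ℝ) < 1 / (2 * (|A| + 1)) := by positivity
  refine ⟨max (max 1 βE) (max (max βSh βV) (2 / (1 / (2 * (|A| + 1))) ^ 3)), fun β hβ φ hφ hsupp => ?_⟩
  have hβ1 : 1 ≤ β := ((le_max_left _ _).trans (le_max_left _ _)).trans hβ
  have hβ0 : 0 < β := by linarith
  have hβE : βE ≤ β := ((le_max_right _ _).trans (le_max_left _ _)).trans hβ
  have hβSh : βSh ≤ β := (((le_max_left _ _).trans (le_max_left _ _)).trans (le_max_right _ _)).trans hβ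
  have hβV : βV ≤ β := (((le_max_right _ _).trans (le_max_left _ _)).trans (le_max_right _ _)).trans hβ
  have hβτ : 2 / (1 / (2 * (|A| + 1))) ^ 3 ≤ β := ((le_max_right _ _).trans (le_max_right _ _)).trans hβ
  set lam := bareLambda ((L : ℝ) ^ 3 * β) with hlam
  have hL1 : (1 : ℝ) ≤ (L : ℝ) ^ 3 := one_le_pow₀ (by exact_mod_cast NeZero.one_le)
  have hB'0 : 0 < (L : ℝ) ^ 3 * β := by positivity
  have hlam0 : 0 < lam := bareLambda_pos' hB'0
  have hlamτ : lam ≤ 1 / (2 * (|A| + 1)) := bareLambda_cube_le (L := L) hτ0 hβτ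
  have hlam1 : lam ≤ 1 := hlamτ.trans (by rw [div_le_one (by positivity)]; linarith [abs_nonneg A])
  have hΛ0 : 0 < levelValue su2Rep L β 0 := levelValue_su2Rep_pos hβ0 0
  -- `e^{−A·lam} ≥ 1/2`
  have hA2 : (1 : ℝ) / 2 ≤ Real.exp (-(A * lam)) := by
    have h1 : A * lam ≤ 1 / 2 := by
      have h2 : A * lam ≤ |A| * lam := mul_le_mul_of_nonneg_right (le_abs_self A) hlam0.le
      have h3 : |A| * lam ≤ |A| * (1 / (2 * (|A| + 1))) := mul_le_mul_of_nonneg_left hlamτ (abs_nonneg A)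
      have h4 : |A| * (1 / (2 * (|A| + 1))) ≤ 1 / 2 := by
        rw [mul_div_assoc', div_le_iff₀ (by positivity)]; nlinarith [abs_nonneg A]
      linarith
    have h5 : Real.exp (-(1 / 2 : ℝ)) ≤ Real.exp (-(A * lam)) := Real.exp_le_exp.2 (by linarith)
    refine le_trans ?_ h5
    -- `1/2 ≤ e^{-1/2}` since `e^{1/2} ≤ 2`
    rw [Real.exp_neg, le_inv_comm₀ (by norm_num) (Real.exp_pos _)]
    have h6 : Real.exp (1 / 2 : ℝ) ≤ 2 := by
      have h7 : Real.exp (1 / 2 : ℝ) ^ 2 = Real.exp 1 := by rw [← Real.exp_nat_mul]; norm_num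
      nlinarith [Real.exp_one_lt_d9, Real.exp_pos (1 / 2 : ℝ)]
    simpa using h6
  -- the margin `e^{−A lam} − e^{−(A+1) lam} ≥ lam/4`
  have hmargin : lam / 4 * levelValue su2Rep L β 0 ≤
      (Real.exp (-(A * lam)) - Real.exp (-((A + 1) * lam))) * levelValue su2Rep L β 0 := by
    refine mul_le_mul_of_nonneg_right ?_ hΛ0.le
    have e1 : Real.exp (-((A + 1) * lam)) = Real.exp (-(A * lam)) * Real.exp (-lam) := by
      rw [← Real.exp_add]; congr 1; ring
    rw [e1, ← mul_one_sub]
    -- `lam/2 ≤ 1 − e^{−lam}` on `[0,1]` (as `Literature…PrimeReciprocal.half_le_one_sub_exp_neg`, inlined to keep the import closure physical)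
    have h8 : lam / 2 ≤ 1 - Real.exp (-lam) := by
      have g1 : 1 + lam ≤ Real.exp lam := by have := Real.add_one_le_exp lam; linarith
      have g2 : 1 ≤ Real.exp lam * (1 - lam / 2) := by
        have : (1 : ℝ) ≤ (1 + lam) * (1 - lam / 2) := by nlinarith
        exact this.trans (mul_le_mul_of_nonneg_right g1 (by linarith))
      have g3 : Real.exp (-lam) * Real.exp lam = 1 := by rw [← Real.exp_add]; simp
      have g4 := Real.exp_pos (-lam)
      nlinarith [mul_le_mul_of_nonneg_left g2 g4.le]
    have h9 : 0 ≤ 1 - Real.exp (-lam) := by linarith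
    nlinarith
  -- the IMS error through the floor
  have herr : (1 / 2) * ((Fintype.card (Edge 3 L) : ℝ) ^ 2 * (8 * π / δ β) ^ 2 * (3 / β) * latCE L β) ≤ lam / 4 * levelValue su2Rep L β 0 := by
    have h1 : (1 / 2) * ((Fintype.card (Edge 3 L) : ℝ) ^ 2 * (3 / β) * (8 * π / δ β) ^ 2) ≤ onionErr L β (δ β) (δ β) :=
      onionErr₂_delta_le_onionErr hβ0 (δ β) (δ β)
    have h2 := (h1.trans (hE β hβE))
    have hCE := (latCE_pos (L := L) hβ0.le).le
    have h3 := mul_le_mul_of_nonneg_right h2 hCE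
    have h4 : 1 / 4 * bareLambda ((L : ℝ) ^ 3 * β) * uniformFloorConst L * latCE L β ≤ lam / 4 * levelValue su2Rep L β 0 := by
      have := mul_le_mul_of_nonneg_left (levelValue_zero_ge_uniform (L := L) hβ1) (by positivity : (0 : ℝ) ≤ 1 / 4 * lam)
      rw [hlam] at this ⊢; linarith [this]
    calc (1 / 2) * ((Fintype.card (Edge 3 L) : ℝ) ^ 2 * (8 * π / δ β) ^ 2 * (3 / β) * latCE L β)
        = (1 / 2) * ((Fintype.card (Edge 3 L) : ℝ) ^ 2 * (3 / β) * (8 * π / δ β) ^ 2) * latCE L β := by ring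
      _ ≤ _ := h3
      _ ≤ _ := h4
  -- the cut
  have hims := qform_le_inner_outer_lat hβ0 (hδ β) hφ
  have hcP : IsPhys fun U => Real.cos (innerPhase (δ β) U) * φ U := isPhys_inner (δ β) hφ
  have hsP : IsPhys fun U => Real.sin (innerPhase (δ β) U) * φ U := isPhys_outer (δ β) hφ
  -- the cos-piece is in the shell
  have hcos := hSh' β hβSh _ hcP fun U hU => by
    refine ⟨exists_orbitDist_lt_of_cos_ne_zero (hδ β) (left_ne_zero_of_mul hU), ?_⟩
    exact (hsupp U (right_ne_zero_of_mul hU)).2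
  -- the sin-piece is in the old valley
  have hsin := hV' β hβV _ hsP fun U hU =>
    ⟨(hsupp U (right_ne_zero_of_mul hU)).1, forall_lt_orbitDist_of_sin_ne_zero (hδ β) (left_ne_zero_of_mul hU)⟩
  have hsplit := l2_cos_add_l2_sin (measurable_innerPhase (δ β)) hφ
  have hφ0 := l2_self_nonneg_lat φ
  -- assemble
  have h1 : qform su2Rep β φ φ ≤ Real.exp (-((A + 1) * lam)) * levelValue su2Rep L β 0 * l2 φ φ + lam / 4 * levelValue su2Rep L β 0 * l2 φ φ := by
    have h2 := mul_le_mul_of_nonneg_right herr hφ0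
    have h4 : Real.exp (-((A + 1) * lam)) * levelValue su2Rep L β 0 * l2 (fun U => Real.cos (innerPhase (δ β) U) * φ U) (fun U => Real.cos (innerPhase (δ β) U) * φ U)
        + Real.exp (-((A + 1) * lam)) * levelValue su2Rep L β 0 * l2 (fun U => Real.sin (innerPhase (δ β) U) * φ U) (fun U => Real.sin (innerPhase (δ β) U) * φ U)
        = Real.exp (-((A + 1) * lam)) * levelValue su2Rep L β 0 * l2 φ φ := by
      rw [← hsplit]; ring
    linarith [hims, hcos, hsin, h2, h4]
  have h3 := mul_le_mul_of_nonneg_right hmargin hφ0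
  linarith [h1, h3]

/-- The SHELL GAIN at polynomial radii `(β^{−s}, β^{−p})`, `0 < p < 1/3`, extends RED's `ValleyGainAt L (β^{−p}) (β^{−q})` down to the core radius:
`ValleyGainAt L (β^{−s}) (β^{−q})`. [cite: Luscher1983, §3] -/
theorem valleyGainAt_pow_of_shell {s p q : ℝ} (hp0 : 0 < p) (hp : p < 1 / 3)
    (hSh : InnerShellGainAt L (powScale s) (powScale p)) (hV : ValleyGainAt L (powScale p) (powScale q)) :
    ValleyGainAt L (powScale s) (powScale q) :=
  valleyGainAt_of_shell (scalesAdmissible_powScale hp0 hp) hSh hV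

/-- Conversely, a VALLEY GAIN at the core radius `δc` whose action threshold swallows the inner ball (`4|P|·δ(β)² < η(β)`) contains the SHELL GAIN
(`orbitDist(τ_z U) < δ ⇒ S(U) ≤ 8δ²|P| < 2η`): the shell is «valley gain near the vacuum». [cite: Luscher1983, §2] -/
theorem innerShellGainAt_of_valleyGainAt {δc δ η : ℝ → ℝ}
    (hη : ∀ β, 4 * (Fintype.card (Plaquette 3 L) : ℝ) * δ β ^ 2 < η β) (hV : ValleyGainAt L δc η) : InnerShellGainAt L δc δ := by
  intro A
  obtain ⟨β0, h⟩ := hV A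
  refine ⟨β0, fun β hβ φ hφ hsupp => h β hβ φ hφ fun U hU => ?_⟩
  obtain ⟨⟨z, hz⟩, hfar⟩ := hsupp U hU
  refine ⟨?_, hfar⟩
  have hS := wilsonAction_le_of_orbitDist_twist3_le z hz.le
  nlinarith [hη β, hS]

/-! ## §3 COARSE-UPPER(L) from the CORE one-orbit statement and the SHELL gain -/

/-- ★★★ **COARSE-UPPER(L) ⇐ C4-CORE + C4-SHELL** at RED's exponent window: for `2 ≤ L`, `(p, q, r, m)` as in `coarseNoIntruderAt_of_inner_pow` and ANY core exponent
`0 < s < 1/3`, the one-orbit INNER NO-INTRUDER at the core radius `β^{−s}` and the SHELL GAIN on `(β^{−s}, β^{−p})` give VERBATIM the body of KTR's `CoarseNoIntruderAt L`.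
(RED's valley gain at `β^{−p}` from the proved k = 0 floor; the shell glue; the onion at radius `β^{−s}`.) [cite: Luscher1983, §3] [cite: LuscherMunster1984, §2] -/
theorem coarseNoIntruderAt_of_core_shell_pow (hL : 2 ≤ L) {p q r m s : ℝ} (hp0 : 0 < p) (hp : p < 1 / 10) (hpq : 4 * p < q) (hq : q < 8 / 9)
    (hr : 0 < r) (hr1 : 2 * r < 1) (hm : 0 < m) (hrq : 2 * r < q - m / 2) (hpm : p < m / 2) (hC : 1 + 3 * m - 3 * r < -p)
    (hs0 : 0 < s) (hs : s < 1 / 3)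
    (hCore : InnerNoIntruderOneOrbitAt L (powScale s)) (hShell : InnerShellGainAt L (powScale s) (powScale p)) :
    ∀ k : ℕ, ∀ d : ℝ, d < levelGap k → ∃ lam0 : ℝ, 0 < lam0 ∧ ∀ lam : ℝ, 0 < lam → lam ≤ lam0 →
      ∀ β : ℝ, InFemtoWindow lam β L →
        levelValue su2Rep L β k ≤ Real.exp (-(d * luscherLambda β L) / L) * levelValue su2Rep L β 0 := by
  have hp3 : p < 1 / 3 := by linarith
  have hV : ValleyGainAt L (powScale p) (powScale q) :=
    FemtoCutoffLadder.valleyGainAt_of_floor_pow hp0 hp3 hpq hr hr1 hm hrq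
      (valleyFloorAt_of_idealCmp_pow hL hp (riccatiN_idealCmp_pow (L := L) hp0 hpm (by linarith) hC hm.le))
  exact coarseNoIntruderAt_of_valley_oneOrbit_pow₉ hs0 hs hq (valleyGainAt_pow_of_shell hp0 hp3 hShell hV) hCore

/-- ★★★ The instance of record: `(p, q, r, m) = (1/40, 17/20, 41/100, 11/200)` and any core exponent `0 < s < 1/3` —
`InnerNoIntruderOneOrbitAt L (powScale s) → InnerShellGainAt L (powScale s) (powScale (1/40)) →` COARSE-UPPER(L). [cite: Luscher1983, §3] -/
theorem coarseNoIntruderAt_of_core_shell_fortieth (hL : 2 ≤ L) {s : ℝ} (hs0 : 0 < s) (hs : s < 1 / 3)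
    (hCore : InnerNoIntruderOneOrbitAt L (powScale s)) (hShell : InnerShellGainAt L (powScale s) (powScale (1 / 40))) :
    ∀ k : ℕ, ∀ d : ℝ, d < levelGap k → ∃ lam0 : ℝ, 0 < lam0 ∧ ∀ lam : ℝ, 0 < lam → lam ≤ lam0 →
      ∀ β : ℝ, InFemtoWindow lam β L →
        levelValue su2Rep L β k ≤ Real.exp (-(d * luscherLambda β L) / L) * levelValue su2Rep L β 0 :=
  coarseNoIntruderAt_of_core_shell_pow hL (q := 17 / 20) (r := 41 / 100) (m := 11 / 200) (by norm_num) (by norm_num) (by norm_num) (by norm_num)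
    (by norm_num) (by norm_num) (by norm_num) (by norm_num) (by norm_num) (by norm_num) hs0 hs hCore hShell

/-- ★★★ **COARSE-UPPER(L) ⇐ the FESHBACH PACKAGE on the core + the SHELL gain**: `InnerBOPackageAt L (powScale s)` (`0 < s < 1/3`; dischargeable at precision
`β^{−2s} = o(λ_b)` when `s > 1/6`) and `InnerShellGainAt L (powScale s) (powScale (1/40))` give COARSE-UPPER(L) (`2 ≤ L`). [cite: Luscher1983, §3] -/
theorem coarseNoIntruderAt_of_package_shell_pow (hL : 2 ≤ L) {s : ℝ} (hs0 : 0 < s) (hs : s < 1 / 3)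
    (hP : InnerBOPackageAt L (powScale s)) (hShell : InnerShellGainAt L (powScale s) (powScale (1 / 40))) :
    ∀ k : ℕ, ∀ d : ℝ, d < levelGap k → ∃ lam0 : ℝ, 0 < lam0 ∧ ∀ lam : ℝ, 0 < lam → lam ≤ lam0 →
      ∀ β : ℝ, InFemtoWindow lam β L →
        levelValue su2Rep L β k ≤ Real.exp (-(d * luscherLambda β L) / L) * levelValue su2Rep L β 0 :=
  coarseNoIntruderAt_of_core_shell_fortieth hL hs0 hs (innerNoIntruderOneOrbitAt_of_package hP) hShell


/-! ## §4 The SMALL-ACTION shell: the valley's action threshold rides through the cut (appended 2026-08-28)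

The `cos`-piece of a VALLEY function inherits its action bound `S < 2η`; recording it in the shell hypothesis makes C4-SHELL strictly weaker (large stiff
amplitudes `β|w|² ≳ βη` never have to be treated in the near-vacuum chart: RED's refined onion has already removed them).  At the exponents of record
`η = β^{−17/20}` this confines the stiff amplitude on the shell to `|w| ≲ β^{−0.42}`, where the cubic corrections `β|w|³ → 0`. -/

section SmallAction

variable (L)

/-- **C4-SHELL, small-action form — INNER SHELL GAIN at radii `(δc, δ)` below the action threshold `2η`** (target text; OPEN; weaker than `InnerShellGainAt L δc δ`).
For every `A`, eventually in `β`: every physical zero-flux `φ` supported in `{S < 2η(β)} ∩ {∃ z, orbitDist(τ_z U) < δ(β)} ∩ {∀ z, δc(β)/2 < orbitDist(τ_z U)}` has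
`⟨φ, K_β φ⟩ ≤ e^{−A·λ_b(L³β)} · λ₀(β, L) · ‖φ‖²`. [cite: Luscher1983, §3] -/
def InnerShellGainSmallAt (δc δ η : ℝ → ℝ) : Prop :=
  ∀ A : ℝ, ∃ β0 : ℝ, ∀ β : ℝ, β0 ≤ β → ∀ φ : GaugeConfig 3 L SU2 → ℝ, IsPhys φ →
    (∀ U, φ U ≠ 0 → wilsonAction su2Rep U < 2 * η β ∧ (∃ z : Fin 3 → Bool, orbitDist (TT.twist3 z U) < δ β) ∧
      ∀ z : Fin 3 → Bool, δc β / 2 < orbitDist (TT.twist3 z U)) →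
      qform su2Rep β φ φ ≤ Real.exp (-(A * bareLambda ((L : ℝ) ^ 3 * β))) * levelValue su2Rep L β 0 * l2 φ φ

variable {L}

/-- The small-action shell gain is weaker than the shell gain. [folklore] -/
theorem innerShellGainSmallAt_of_shellGain {δc δ η : ℝ → ℝ} (h : InnerShellGainAt L δc δ) : InnerShellGainSmallAt L δc δ η := by
  intro A
  obtain ⟨β0, h'⟩ := h A
  exact ⟨β0, fun β hβ φ hφ hsupp => h' β hβ φ hφ fun U hU => (hsupp U hU).2⟩

/-- ★★ **VALLEY GAIN down to the core radius from the SMALL-ACTION SHELL GAIN + VALLEY GAIN at the intermediate radius** (`ScalesAdmissible L δ δ`):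
`InnerShellGainSmallAt L δc δ η → ValleyGainAt L δ η → ValleyGainAt L δc η` — as `valleyGainAt_of_shell`, the `cos`-piece keeping the action bound of `φ`.
[cite: Luscher1983, §3] [cite: SimonB1983DiscreteSpectrum, §3] -/
theorem valleyGainAt_of_shellSmall {δc δ η : ℝ → ℝ} (hS : ScalesAdmissible L δ δ) (hSh : InnerShellGainSmallAt L δc δ η) (hV : ValleyGainAt L δ η) :
    ValleyGainAt L δc η := by
  intro A
  obtain ⟨hδ, -, hErr⟩ := hS
  obtain ⟨βSh, hSh'⟩ := hSh (A + 1)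
  obtain ⟨βV, hV'⟩ := hV (A + 1)
  obtain ⟨βE, hE⟩ := hErr (1 / 4) (by norm_num)
  have hτ0 : (0 : ℝ) < 1 / (2 * (|A| + 1)) := by positivity
  refine ⟨max (max 1 βE) (max (max βSh βV) (2 / (1 / (2 * (|A| + 1))) ^ 3)), fun β hβ φ hφ hsupp => ?_⟩
  have hβ1 : 1 ≤ β := ((le_max_left _ _).trans (le_max_left _ _)).trans hβ
  have hβ0 : 0 < β := by linarith
  have hβE : βE ≤ β := ((le_max_right _ _).trans (le_max_left _ _)).trans hβ
  have hβSh : βSh ≤ β := (((le_max_left _ _).trans (le_max_left _ _)).trans (le_max_right _ _)).trans hβ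
  have hβV : βV ≤ β := (((le_max_right _ _).trans (le_max_left _ _)).trans (le_max_right _ _)).trans hβ
  have hβτ : 2 / (1 / (2 * (|A| + 1))) ^ 3 ≤ β := ((le_max_right _ _).trans (le_max_right _ _)).trans hβ
  set lam := bareLambda ((L : ℝ) ^ 3 * β) with hlam
  have hL1 : (1 : ℝ) ≤ (L : ℝ) ^ 3 := one_le_pow₀ (by exact_mod_cast NeZero.one_le)
  have hB'0 : 0 < (L : ℝ) ^ 3 * β := by positivity
  have hlam0 : 0 < lam := bareLambda_pos' hB'0
  have hlamτ : lam ≤ 1 / (2 * (|A| + 1)) := bareLambda_cube_le (L := L) hτ0 hβτ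
  have hlam1 : lam ≤ 1 := hlamτ.trans (by rw [div_le_one (by positivity)]; linarith [abs_nonneg A])
  have hΛ0 : 0 < levelValue su2Rep L β 0 := levelValue_su2Rep_pos hβ0 0
  have hA2 : (1 : ℝ) / 2 ≤ Real.exp (-(A * lam)) := by
    have h1 : A * lam ≤ 1 / 2 := by
      have h2 : A * lam ≤ |A| * lam := mul_le_mul_of_nonneg_right (le_abs_self A) hlam0.le
      have h3 : |A| * lam ≤ |A| * (1 / (2 * (|A| + 1))) := mul_le_mul_of_nonneg_left hlamτ (abs_nonneg A)
      have h4 : |A| * (1 / (2 * (|A| + 1))) ≤ 1 / 2 := by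
        rw [mul_div_assoc', div_le_iff₀ (by positivity)]; nlinarith [abs_nonneg A]
      linarith
    have h5 : Real.exp (-(1 / 2 : ℝ)) ≤ Real.exp (-(A * lam)) := Real.exp_le_exp.2 (by linarith)
    refine le_trans ?_ h5
    rw [Real.exp_neg, le_inv_comm₀ (by norm_num) (Real.exp_pos _)]
    have h6 : Real.exp (1 / 2 : ℝ) ≤ 2 := by
      have h7 : Real.exp (1 / 2 : ℝ) ^ 2 = Real.exp 1 := by rw [← Real.exp_nat_mul]; norm_num
      nlinarith [Real.exp_one_lt_d9, Real.exp_pos (1 / 2 : ℝ)]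
    simpa using h6
  have hmargin : lam / 4 * levelValue su2Rep L β 0 ≤
      (Real.exp (-(A * lam)) - Real.exp (-((A + 1) * lam))) * levelValue su2Rep L β 0 := by
    refine mul_le_mul_of_nonneg_right ?_ hΛ0.le
    have e1 : Real.exp (-((A + 1) * lam)) = Real.exp (-(A * lam)) * Real.exp (-lam) := by
      rw [← Real.exp_add]; congr 1; ring
    rw [e1, ← mul_one_sub]
    have h8 : lam / 2 ≤ 1 - Real.exp (-lam) := by
      have g1 : 1 + lam ≤ Real.exp lam := by have := Real.add_one_le_exp lam; linarith
      have g2 : 1 ≤ Real.exp lam * (1 - lam / 2) := by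
        have : (1 : ℝ) ≤ (1 + lam) * (1 - lam / 2) := by nlinarith
        exact this.trans (mul_le_mul_of_nonneg_right g1 (by linarith))
      have g3 : Real.exp (-lam) * Real.exp lam = 1 := by rw [← Real.exp_add]; simp
      have g4 := Real.exp_pos (-lam)
      nlinarith [mul_le_mul_of_nonneg_left g2 g4.le]
    have h9 : 0 ≤ 1 - Real.exp (-lam) := by linarith
    nlinarith
  have herr : (1 / 2) * ((Fintype.card (Edge 3 L) : ℝ) ^ 2 * (8 * π / δ β) ^ 2 * (3 / β) * latCE L β) ≤ lam / 4 * levelValue su2Rep L β 0 := by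
    have h1 : (1 / 2) * ((Fintype.card (Edge 3 L) : ℝ) ^ 2 * (3 / β) * (8 * π / δ β) ^ 2) ≤ onionErr L β (δ β) (δ β) :=
      onionErr₂_delta_le_onionErr hβ0 (δ β) (δ β)
    have h2 := (h1.trans (hE β hβE))
    have hCE := (latCE_pos (L := L) hβ0.le).le
    have h3 := mul_le_mul_of_nonneg_right h2 hCE
    have h4 : 1 / 4 * bareLambda ((L : ℝ) ^ 3 * β) * uniformFloorConst L * latCE L β ≤ lam / 4 * levelValue su2Rep L β 0 := by
      have := mul_le_mul_of_nonneg_left (levelValue_zero_ge_uniform (L := L) hβ1) (by positivity : (0 : ℝ) ≤ 1 / 4 * lam)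
      rw [hlam] at this ⊢; linarith [this]
    calc (1 / 2) * ((Fintype.card (Edge 3 L) : ℝ) ^ 2 * (8 * π / δ β) ^ 2 * (3 / β) * latCE L β)
        = (1 / 2) * ((Fintype.card (Edge 3 L) : ℝ) ^ 2 * (3 / β) * (8 * π / δ β) ^ 2) * latCE L β := by ring
      _ ≤ _ := h3
      _ ≤ _ := h4
  have hims := qform_le_inner_outer_lat hβ0 (hδ β) hφ
  have hcP : IsPhys fun U => Real.cos (innerPhase (δ β) U) * φ U := isPhys_inner (δ β) hφ
  have hsP : IsPhys fun U => Real.sin (innerPhase (δ β) U) * φ U := isPhys_outer (δ β) hφ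
  -- the cos-piece is in the small-action shell (action bound inherited from `φ`)
  have hcos := hSh' β hβSh _ hcP fun U hU => by
    refine ⟨(hsupp U (right_ne_zero_of_mul hU)).1, exists_orbitDist_lt_of_cos_ne_zero (hδ β) (left_ne_zero_of_mul hU), ?_⟩
    exact (hsupp U (right_ne_zero_of_mul hU)).2
  have hsin := hV' β hβV _ hsP fun U hU =>
    ⟨(hsupp U (right_ne_zero_of_mul hU)).1, forall_lt_orbitDist_of_sin_ne_zero (hδ β) (left_ne_zero_of_mul hU)⟩
  have hsplit := l2_cos_add_l2_sin (measurable_innerPhase (δ β)) hφ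
  have hφ0 := l2_self_nonneg_lat φ
  have h1 : qform su2Rep β φ φ ≤ Real.exp (-((A + 1) * lam)) * levelValue su2Rep L β 0 * l2 φ φ + lam / 4 * levelValue su2Rep L β 0 * l2 φ φ := by
    have h2 := mul_le_mul_of_nonneg_right herr hφ0
    have h4 : Real.exp (-((A + 1) * lam)) * levelValue su2Rep L β 0 * l2 (fun U => Real.cos (innerPhase (δ β) U) * φ U) (fun U => Real.cos (innerPhase (δ β) U) * φ U)
        + Real.exp (-((A + 1) * lam)) * levelValue su2Rep L β 0 * l2 (fun U => Real.sin (innerPhase (δ β) U) * φ U) (fun U => Real.sin (innerPhase (δ β) U) * φ U)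
        = Real.exp (-((A + 1) * lam)) * levelValue su2Rep L β 0 * l2 φ φ := by
      rw [← hsplit]; ring
    linarith [hims, hcos, hsin, h2, h4]
  have h3 := mul_le_mul_of_nonneg_right hmargin hφ0
  linarith [h1, h3]

/-- Polynomial radii: `InnerShellGainSmallAt L (β^{−s}) (β^{−p}) (β^{−q}) → ValleyGainAt L (β^{−p}) (β^{−q}) → ValleyGainAt L (β^{−s}) (β^{−q})` (`0 < p < 1/3`).
[cite: Luscher1983, §3] -/
theorem valleyGainAt_pow_of_shellSmall {s p q : ℝ} (hp0 : 0 < p) (hp : p < 1 / 3)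
    (hSh : InnerShellGainSmallAt L (powScale s) (powScale p) (powScale q)) (hV : ValleyGainAt L (powScale p) (powScale q)) :
    ValleyGainAt L (powScale s) (powScale q) :=
  valleyGainAt_of_shellSmall (scalesAdmissible_powScale hp0 hp) hSh hV

/-- ★★★ **COARSE-UPPER(L) ⇐ C4-CORE + small-action C4-SHELL** at RED's window: as `coarseNoIntruderAt_of_core_shell_pow` with the shell hypothesis weakened to
`InnerShellGainSmallAt L (powScale s) (powScale p) (powScale q)`. [cite: Luscher1983, §3] [cite: LuscherMunster1984, §2] -/
theorem coarseNoIntruderAt_of_core_shellSmall_pow (hL : 2 ≤ L) {p q r m s : ℝ} (hp0 : 0 < p) (hp : p < 1 / 10) (hpq : 4 * p < q) (hq : q < 8 / 9)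
    (hr : 0 < r) (hr1 : 2 * r < 1) (hm : 0 < m) (hrq : 2 * r < q - m / 2) (hpm : p < m / 2) (hC : 1 + 3 * m - 3 * r < -p)
    (hs0 : 0 < s) (hs : s < 1 / 3)
    (hCore : InnerNoIntruderOneOrbitAt L (powScale s)) (hShell : InnerShellGainSmallAt L (powScale s) (powScale p) (powScale q)) :
    ∀ k : ℕ, ∀ d : ℝ, d < levelGap k → ∃ lam0 : ℝ, 0 < lam0 ∧ ∀ lam : ℝ, 0 < lam → lam ≤ lam0 →
      ∀ β : ℝ, InFemtoWindow lam β L →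
        levelValue su2Rep L β k ≤ Real.exp (-(d * luscherLambda β L) / L) * levelValue su2Rep L β 0 := by
  have hp3 : p < 1 / 3 := by linarith
  have hV : ValleyGainAt L (powScale p) (powScale q) :=
    FemtoCutoffLadder.valleyGainAt_of_floor_pow hp0 hp3 hpq hr hr1 hm hrq
      (valleyFloorAt_of_idealCmp_pow hL hp (riccatiN_idealCmp_pow (L := L) hp0 hpm (by linarith) hC hm.le))
  exact coarseNoIntruderAt_of_valley_oneOrbit_pow₉ hs0 hs hq (valleyGainAt_pow_of_shellSmall hp0 hp3 hShell hV) hCore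

/-- ★★★ The instance of record with the small-action shell: `(p, q, r, m) = (1/40, 17/20, 41/100, 11/200)`, any `0 < s < 1/3`:
`InnerNoIntruderOneOrbitAt L (powScale s) → InnerShellGainSmallAt L (powScale s) (powScale (1/40)) (powScale (17/20)) →` COARSE-UPPER(L). [cite: Luscher1983, §3] -/
theorem coarseNoIntruderAt_of_core_shellSmall_fortieth (hL : 2 ≤ L) {s : ℝ} (hs0 : 0 < s) (hs : s < 1 / 3)
    (hCore : InnerNoIntruderOneOrbitAt L (powScale s))
    (hShell : InnerShellGainSmallAt L (powScale s) (powScale (1 / 40)) (powScale (17 / 20))) :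
    ∀ k : ℕ, ∀ d : ℝ, d < levelGap k → ∃ lam0 : ℝ, 0 < lam0 ∧ ∀ lam : ℝ, 0 < lam → lam ≤ lam0 →
      ∀ β : ℝ, InFemtoWindow lam β L →
        levelValue su2Rep L β k ≤ Real.exp (-(d * luscherLambda β L) / L) * levelValue su2Rep L β 0 :=
  coarseNoIntruderAt_of_core_shellSmall_pow hL (q := 17 / 20) (r := 41 / 100) (m := 11 / 200) (by norm_num) (by norm_num) (by norm_num) (by norm_num)
    (by norm_num) (by norm_num) (by norm_num) (by norm_num) (by norm_num) (by norm_num) hs0 hs hCore hShell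

/-- ★★★ **COARSE-UPPER(L) ⇐ the FESHBACH PACKAGE on the core `β^{−s}` + the small-action SHELL gain** (`2 ≤ L`, `0 < s < 1/3`). [cite: Luscher1983, §3] -/
theorem coarseNoIntruderAt_of_package_shellSmall_pow (hL : 2 ≤ L) {s : ℝ} (hs0 : 0 < s) (hs : s < 1 / 3)
    (hP : InnerBOPackageAt L (powScale s)) (hShell : InnerShellGainSmallAt L (powScale s) (powScale (1 / 40)) (powScale (17 / 20))) :
    ∀ k : ℕ, ∀ d : ℝ, d < levelGap k → ∃ lam0 : ℝ, 0 < lam0 ∧ ∀ lam : ℝ, 0 < lam → lam ≤ lam0 →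
      ∀ β : ℝ, InFemtoWindow lam β L →
        levelValue su2Rep L β k ≤ Real.exp (-(d * luscherLambda β L) / L) * levelValue su2Rep L β 0 :=
  coarseNoIntruderAt_of_core_shellSmall_fortieth hL hs0 hs (innerNoIntruderOneOrbitAt_of_package hP) hShell

end SmallAction

end Summit.QuantumFields.YangMills.Theorems.FemtoTransferGap

end
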